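import Literature.AlgebraicGeometry.Resolution.RegularLocalRingsProofs
import Mathlib.RingTheory.KrullDimension.Regular
import Mathlib.RingTheory.Ideal.Cotangent
import Mathlib.RingTheory.Smooth.Local
import Mathlib.RingTheory.Smooth.Locus
import Mathlib.RingTheory.Etale.Kaehler
import Mathlib.RingTheory.Kaehler.Polynomial
import Mathlib.RingTheory.RegularLocalRing.Polynomial
import Mathlib.RingTheory.FiniteType
import HarnessLib

/-!
# Smooth over a field ⇒ regular (EGA IV 17.5.8 (iii), field case; Görtz–Wedhorn 6.26)

Topic: `Literature/AlgebraicGeometry/Resolution`. We PROVE the field case of EGA IV₄ 17.5.8 (iii)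
("a scheme smooth over a regular base is regular"), which is all the assembly of
`KnafKuhlmann2009` (`KnafKuhlmann2009Assembly.lean`, via `KnafKuhlmann2009.of_thm12`) needs of
the named fact `Grothendieck1967_17_5_8` (`SmoothUniformization.lean`):

* `isRegularLocalRing_quotient_span` — Matsumura, *Commutative Ring Theory*, Thm. 14.2: the
  quotient of a regular local ring by elements with linearly independent images in `𝔪/𝔪²` is
  regular (Nakayama + Krull's height theorem, both from Mathlib).
* `isRegularLocalRing_of_isSmoothAt` — for a finitely presented algebra `A` over a field `K`
  and a prime `q` at which `A` is smooth (`Algebra.IsSmoothAt`, i.e. `A_q` formally smooth over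
  `K`), the local ring `A_q` is regular. Proof: present `A_q = P/I` with `P` a local ring of an
  affine space over `K` (regular: Mathlib's `IsRegularRing (MvPolynomial (Fin n) K)`); Mathlib's
  Jacobian criterion for formal smoothness of local algebras
  (`Algebra.FormallySmooth.iff_injective_cotangentComplexBaseChange`) says that
  `k ⊗ I → k ⊗ Ω_{P/K}` is injective; hence minimal generators `f₁, …, f_c` of `I` (Nakayama) have
  linearly independent images already in `𝔪/𝔪²` (a relation `∑ gᵢ fᵢ ∈ 𝔪²` differentiates to
  `∑ ḡᵢ dfᵢ = 0` in `k ⊗ Ω`), and Thm. 14.2 applies.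

## Sources

* A. Grothendieck, *EGA IV₄*, Publ. Math. IHÉS 32 (1967), Prop. 17.5.8 (iii).
* U. Görtz, T. Wedhorn, *Algebraic Geometry I*, 2nd ed. (2020), Lemma 6.26 (p. 196): "smooth
  over a field ⇒ the local rings are regular".
* H. Matsumura, *Commutative Ring Theory*, CUP 1986/87, Thm. 14.2 (p. 105).
-/

noncomputable section

namespace Literature.AlgebraicGeometry.Resolution

universe u

open IsLocalRing Module

/-- The Krull dimension of a Noetherian local ring, as a natural number. [folklore] -/
theorem exists_ringKrullDim_eq_natCast (R : Type u) [CommRing R] [IsLocalRing R]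
    [IsNoetherianRing R] : ∃ n : ℕ, ringKrullDim R = n := by
  have h1 : ringKrullDim R ≠ ⊥ := ringKrullDim_ne_bot
  have h2 : ringKrullDim R ≠ ⊤ := ringKrullDim_ne_top
  obtain ⟨a, ha⟩ := WithBot.ne_bot_iff_exists.mp h1
  have ha' : a ≠ ⊤ := fun h => h2 (by rw [← ha, h]; rfl)
  obtain ⟨n, rfl⟩ := WithTop.ne_top_iff_exists.mp ha'
  exact ⟨n, ha.symm⟩

/-- **Matsumura, Thm. 14.2** (regular quotients): if `R` is a regular local ring and
`x₁, …, x_c ∈ 𝔪` have linearly independent images in `𝔪/𝔪²`, then `R/(x₁, …, x_c)` is a regular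
local ring (of dimension `dim R - c`). Proof: extend the images to a basis of `𝔪/𝔪²` and lift —
by Nakayama `𝔪` is generated by the `xᵢ` and `dim R - c` further elements, so the maximal ideal
of the quotient needs at most `dim R - c` generators, while `dim R/(x) ≥ dim R - c` by Krull.
[cite: Matsumura1987, Thm. 14.2] -/
theorem isRegularLocalRing_quotient_span {R : Type u} [CommRing R] [IsRegularLocalRing R]
    (s : Finset R) (hs : (s : Set R) ⊆ maximalIdeal R)
    (hli : LinearIndependent (ResidueField R)
      (fun x : s => (maximalIdeal R).toCotangent ⟨x, hs x.2⟩)) :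
    IsRegularLocalRing (R ⧸ Ideal.span (s : Set R)) := by
  classical
  set m := maximalIdeal R with hm
  set J : Ideal R := Ideal.span (s : Set R) with hJ
  have hJm : J ≤ m := Ideal.span_le.mpr hs
  have hJtop : J ≠ ⊤ := fun h => (IsLocalRing.maximalIdeal.isMaximal R).ne_top (top_le_iff.mp (h ▸ hJm))
  haveI : Nontrivial (R ⧸ J) := Ideal.Quotient.nontrivial_iff.mpr hJtop
  haveI : IsLocalRing (R ⧸ J) :=
    IsLocalRing.of_surjective' (Ideal.Quotient.mk J) Ideal.Quotient.mk_surjective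
  -- the images `V` of `s` in the cotangent space: a linearly independent set with `#V = #s`
  let v : s → CotangentSpace R := fun x => m.toCotangent ⟨x, hs x.2⟩
  set V : Set (CotangentSpace R) := Set.range v with hV
  have hvinj : Function.Injective v := hli.injective
  have hliV : LinearIndepOn (ResidueField R) id V := hli.linearIndepOn_id
  have hVfin : V.Finite := Set.finite_range v
  have hVcard : V.ncard = s.card := by
    rw [hV, Set.ncard_range_of_injective hvinj, Nat.card_eq_fintype_card, Fintype.card_coe]
  -- extend to a basis `T ⊇ V`
  set T : Set (CotangentSpace R) := hliV.extend (Set.subset_univ _) with hT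
  let b : Basis T (ResidueField R) (CotangentSpace R) := Basis.extend hliV
  have hVT : V ⊆ T := hliV.subset_extend _
  have hTfin : T.Finite := Set.finite_coe_iff.mp (Module.Finite.finite_basis b)
  have hcardT : T.ncard = m.spanFinrank := by
    rw [spanFinrank_maximalIdeal_eq_finrank_cotangentSpace, Module.finrank_eq_nat_card_basis b,
      Nat.card_coe_set_eq]
  have hspanT : Submodule.span (ResidueField R) T = ⊤ := by
    rw [← b.span_eq, Basis.range_extend]
  -- lift `T \ V` to `m`; with the `xᵢ` these lifts generate `m` (Nakayama)
  let σ : CotangentSpace R → m := Function.surjInv m.toCotangent_surjective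
  have hσ : ∀ w, m.toCotangent (σ w) = w := Function.surjInv_eq m.toCotangent_surjective
  let sm : Set m := Set.range fun x : s => (⟨x, hs x.2⟩ : m)
  let S : Set m := sm ∪ σ '' (T \ V)
  have hS : m.toCotangent '' S = T := by
    have h1 : m.toCotangent '' sm = V := by
      rw [hV, ← Set.range_comp]
      rfl
    simp only [S, Set.image_union, Set.image_image, hσ, Set.image_id', h1]
    exact Set.union_sdiff_cancel hVT
  have hspanS : Submodule.span R S = ⊤ := by
    rw [← CotangentSpace.span_image_eq_top_iff, hS, hspanT]
  set t : Set R := (fun w : m => (w : R)) '' (σ '' (T \ V)) with ht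
  have htfin : t.Finite := (hTfin.sdiff.image _).image _
  have htcard : t.ncard + s.card ≤ m.spanFinrank := by
    have h1 : t.ncard ≤ (T \ V).ncard :=
      (Set.ncard_image_le (hTfin.sdiff.image _)).trans (Set.ncard_image_le hTfin.sdiff)
    have h2 : (T \ V).ncard + V.ncard = T.ncard := Set.ncard_sdiff_add_ncard_of_subset hVT hTfin
    omega
  have hmgen : m = Ideal.span ((s : Set R) ∪ t) := by
    have h1 : (s : Set R) ∪ t = m.subtype '' S := by
      simp only [S, Set.image_union, Submodule.coe_subtype, ht]
      congr 1
      ext x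
      simp only [sm, Set.mem_image, Set.mem_range, Finset.mem_coe]
      constructor
      · intro hx
        exact ⟨⟨x, hs hx⟩, ⟨⟨x, hx⟩, rfl⟩, rfl⟩
      · rintro ⟨_, ⟨y, rfl⟩, rfl⟩
        exact y.2
    rw [h1, Ideal.span, Submodule.span_image, hspanS, Submodule.map_top, Submodule.range_subtype]
  -- the maximal ideal of `R/J` is generated by the image of `t`
  have hmax : maximalIdeal (R ⧸ J) = Ideal.span ((Ideal.Quotient.mk J) '' t) := by
    rw [maximalIdeal_quotient_eq_map J, ← hm, hmgen, Ideal.map_span, Set.image_union]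
    apply le_antisymm
    · refine Ideal.span_le.mpr (Set.union_subset ?_ Ideal.subset_span)
      rintro _ ⟨x, hx, rfl⟩
      have : Ideal.Quotient.mk J x = 0 :=
        Ideal.Quotient.eq_zero_iff_mem.mpr (Ideal.subset_span hx)
      rw [this]
      exact zero_mem _
    · exact Ideal.span_mono Set.subset_union_right
  have hspan' : (maximalIdeal (R ⧸ J)).spanFinrank ≤ t.ncard := by
    rw [hmax]
    exact (Submodule.spanFinrank_span_le_ncard_of_finite (htfin.image _)).trans
      (Set.ncard_image_le htfin)
  -- dimension count
  obtain ⟨n, hn⟩ := exists_ringKrullDim_eq_natCast (R ⧸ J)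
  have hdimR : ringKrullDim R = m.spanFinrank := (IsRegularLocalRing.spanFinrank_maximalIdeal).symm
  have hkrull := ringKrullDim_le_ringKrullDim_quotient_add_card s
    (by rw [IsLocalRing.ringJacobson_eq_maximalIdeal]; exact hs)
  rw [← hJ, hn, hdimR] at hkrull
  have hkrull' : m.spanFinrank ≤ n + s.card := by
    have : ((m.spanFinrank : ℕ) : WithBot ℕ∞) ≤ ((n + s.card : ℕ) : WithBot ℕ∞) := by
      rw [Nat.cast_add]
      exact hkrull
    exact_mod_cast this
  refine IsRegularLocalRing.of_spanFinrank_maximalIdeal_le _ ?_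
  rw [hn]
  exact_mod_cast (show (maximalIdeal (R ⧸ J)).spanFinrank ≤ n by omega)

/-- Linear independence in `𝔪/𝔪²` from the ring-level condition "`∑ gᵢ xᵢ ∈ 𝔪²` forces all
`gᵢ ∈ 𝔪`". [folklore] -/
theorem linearIndependent_toCotangent_of_forall {R : Type u} [CommRing R] [IsLocalRing R]
    (s : Finset R) (hs : (s : Set R) ⊆ maximalIdeal R)
    (h : ∀ g : ↥s → R, (∑ i, g i * (i : R)) ∈ (maximalIdeal R) ^ 2 → ∀ i, g i ∈ maximalIdeal R) :
    LinearIndependent (ResidueField R)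
      (fun x : s => (maximalIdeal R).toCotangent ⟨x, hs x.2⟩) := by
  classical
  rw [Fintype.linearIndependent_iff]
  intro c hc i
  -- lift the coefficients to `R`
  choose g hg using fun i => Ideal.Quotient.mk_surjective (c i)
  have hsum : (maximalIdeal R).toCotangent
      (∑ i, g i • (⟨(i : R), hs i.2⟩ : maximalIdeal R)) = 0 := by
    rw [map_sum]
    rw [← hc]
    refine Finset.sum_congr rfl fun i _ => ?_
    rw [LinearMap.map_smul_of_tower, ← hg i]
    rfl
  have hmem : (∑ i, g i * (i : R)) ∈ (maximalIdeal R) ^ 2 := by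
    have := ((maximalIdeal R).toCotangent_eq_zero _).mp hsum
    simpa [Submodule.coe_sum, smul_eq_mul] using this
  have hgi := h g hmem i
  rw [← hg i]
  exact (Ideal.Quotient.eq_zero_iff_mem.mpr hgi)

/-! ## Differentials of elements of `𝔪²` vanish in `Ω ⊗ k` -/

section Differentials

open TensorProduct KaehlerDifferential

variable {R P : Type*} [CommRing R] [CommRing P] [Algebra R P] [IsLocalRing P]

/-- In `k ⊗_P Ω_{P/R}` (`k` the residue field of the local ring `P`), `1 ⊗ d(h) = 0` for
`h ∈ 𝔪²` (Leibniz). [folklore] -/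
theorem one_tmul_D_eq_zero_of_mem_sq {h : P} (hh : h ∈ (maximalIdeal P) ^ 2) :
    (1 : ResidueField P) ⊗ₜ[P] D R P h = (0 : ResidueField P ⊗[P] Ω[P⁄R]) := by
  rw [pow_two] at hh
  refine Submodule.mul_induction_on hh (fun a ha b hb => ?_) (fun x y hx hy => ?_)
  · rw [Derivation.leibniz, tmul_add, tmul_smul, tmul_smul, smul_tmul', smul_tmul',
      ← Algebra.algebraMap_eq_smul_one, ← Algebra.algebraMap_eq_smul_one]
    change residue P a ⊗ₜ[P] D R P b + residue P b ⊗ₜ[P] D R P a = 0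
    rw [(residue_eq_zero_iff a).mpr ha, (residue_eq_zero_iff b).mpr hb, zero_tmul, zero_tmul]
    simp
  · rw [map_add, tmul_add, hx, hy, add_zero]

/-- If `fᵢ ∈ 𝔪` and `∑ gᵢ fᵢ ∈ 𝔪²`, then `∑ ḡᵢ (1 ⊗ dfᵢ) = 0` in `k ⊗_P Ω_{P/R}`. [folklore] -/
theorem sum_residue_smul_one_tmul_D_eq_zero {ι : Type*} [Fintype ι] (g f : ι → P)
    (hf : ∀ i, f i ∈ maximalIdeal P) (hgf : (∑ i, g i * f i) ∈ (maximalIdeal P) ^ 2) :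
    (∑ i, residue P (g i) • ((1 : ResidueField P) ⊗ₜ[P] D R P (f i))) =
      (0 : ResidueField P ⊗[P] Ω[P⁄R]) := by
  have h1 : ∀ i, residue P (g i) • ((1 : ResidueField P) ⊗ₜ[P] D R P (f i)) =
      (1 : ResidueField P) ⊗ₜ[P] (g i • D R P (f i)) := by
    intro i
    rw [smul_tmul', tmul_smul, smul_tmul']
    congr 1
  simp_rw [h1]
  rw [← tmul_sum]
  have h2 : (∑ i, g i • D R P (f i)) = D R P (∑ i, g i * f i) - ∑ i, f i • D R P (g i) := by
    rw [map_sum, eq_sub_iff_add_eq, ← Finset.sum_add_distrib]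
    exact Finset.sum_congr rfl fun i _ => by rw [Derivation.leibniz]
  rw [h2, tmul_sub, one_tmul_D_eq_zero_of_mem_sq hgf, zero_sub, neg_eq_zero, tmul_sum]
  refine Finset.sum_eq_zero fun i _ => ?_
  rw [tmul_smul, smul_tmul', ← Algebra.algebraMap_eq_smul_one]
  change residue P (f i) ⊗ₜ[P] D R P (g i) = 0
  rw [(residue_eq_zero_iff _).mpr (hf i), zero_tmul]

end Differentials

/-! ## Smooth over a field at a prime ⇒ the local ring is regular -/

open TensorProduct KaehlerDifferential in
/-- **EGA IV 17.5.8 (iii), field case; Görtz–Wedhorn 6.26**: a finitely presented algebra `A`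
over a field `K` that is smooth at a prime `q` (`Algebra.IsSmoothAt`: `A_q` formally smooth) has a
regular local ring `A_q`. Proof: present `A_q = P/I` with `P` a local ring of the affine space
(regular); by the Jacobian criterion for formal smoothness of local algebras the map
`I/𝔪I → Ω_{P/K} ⊗ k` is injective, so minimal generators of `I` have linearly independent
images in `𝔪/𝔪²` (their differentials are independent), and the quotient is regular by
Matsumura 14.2. [cite: GortzWedhorn2020, Lemma 6.26 (p. 196)] -/
theorem isRegularLocalRing_of_isSmoothAt (K A : Type u) [Field K] [CommRing A] [Algebra K A]
    [Algebra.FinitePresentation K A] (q : Ideal A) [q.IsPrime] [Algebra.IsSmoothAt K q] :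
    IsRegularLocalRing (Localization.AtPrime q) := by
  classical
  let S := Localization.AtPrime q
  have hSsm : Algebra.FormallySmooth K S := ‹Algebra.IsSmoothAt K q›
  -- a presentation `P = K[X]_𝔓 ↠ S = A_q`
  obtain ⟨n, f₀, hf₀⟩ := Algebra.FiniteType.iff_quotient_mvPolynomial''.mp
    (inferInstance : Algebra.FiniteType K A)
  let 𝔓 : Ideal (MvPolynomial (Fin n) K) := q.comap f₀
  haveI : 𝔓.IsPrime := Ideal.comap_isPrime f₀ q
  let P := Localization.AtPrime 𝔓
  haveI : IsRegularLocalRing P := IsRegularRing.isRegularLocalRing_localization 𝔓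
  let fP : P →ₐ[K] S := IsLocalization.liftAlgHom (M := 𝔓.primeCompl)
      (f := (IsScalarTower.toAlgHom K A S).comp f₀) fun x => by
    have hx : f₀ x.1 ∈ q.primeCompl := x.2
    simpa using IsLocalization.map_units (M := q.primeCompl) S ⟨f₀ x.1, hx⟩
  have hf₁ : Function.Surjective fP := by
    intro x
    obtain ⟨x, ⟨s, hs⟩, rfl⟩ := IsLocalization.exists_mk'_eq q.primeCompl x
    obtain ⟨x, rfl⟩ := hf₀ x
    obtain ⟨s, rfl⟩ := hf₀ s
    refine ⟨IsLocalization.mk' (M := 𝔓.primeCompl) P x ⟨s, hs⟩, ?_⟩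
    simp [fP, IsLocalization.lift_mk', Units.mul_inv_eq_iff_eq_mul, IsUnit.liftRight]
  algebraize [fP.toRingHom]
  haveI : IsScalarTower K P S := IsScalarTower.of_algebraMap_eq fun c => (fP.commutes c).symm
  have hf₂ : (RingHom.ker (algebraMap P S)).FG := IsNoetherian.noetherian _
  haveI : Algebra.FormallyEtale (MvPolynomial (Fin n) K) P := .of_isLocalization 𝔓.primeCompl
  haveI : Algebra.FormallySmooth K P := .comp _ (MvPolynomial (Fin n) K) _
  haveI : Module.Free P Ω[P⁄K] :=
    .of_equiv (KaehlerDifferential.tensorKaehlerEquivOfFormallyEtale K (MvPolynomial (Fin n) K) P)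
  haveI : Module.Finite P Ω[P⁄K] :=
    Module.Finite.equiv (KaehlerDifferential.tensorKaehlerEquivOfFormallyEtale K (MvPolynomial (Fin n) K) P)
  -- the ideal `I` of the presentation lies in the maximal ideal; `P → S` detects units
  set I : Ideal P := RingHom.ker (algebraMap P S) with hI
  have hf₁' : Function.Surjective (algebraMap P S) := hf₁
  have hmemP : ∀ x : P, algebraMap P S x ∈ maximalIdeal S → x ∈ maximalIdeal P := by
    intro x hx
    by_contra hxm
    have hxu : IsUnit x := not_not.mp fun h => hxm ((IsLocalRing.mem_maximalIdeal x).mpr h)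
    exact (IsLocalRing.mem_maximalIdeal _).mp hx (hxu.map _)
  have hIm : I ≤ maximalIdeal P := fun x hx =>
    hmemP x (by rw [RingHom.mem_ker.mp hx]; exact zero_mem _)
  -- the residue field `kP` of `P` as an `S`-algebra
  let kP := ResidueField P
  have hkerle : RingHom.ker (algebraMap P S) ≤ RingHom.ker (residue P) := by
    intro x hx
    exact (RingHom.mem_ker).mpr ((residue_eq_zero_iff x).mpr (hIm hx))
  let gS : S →+* kP := (algebraMap P S).liftOfSurjective hf₁' ⟨residue P, hkerle⟩
  have hgS : ∀ x : P, gS (algebraMap P S x) = residue P x := fun x =>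
    (algebraMap P S).liftOfSurjective_comp_apply hf₁' ⟨residue P, hkerle⟩ x
  letI : Algebra S kP := gS.toAlgebra
  haveI : IsScalarTower P S kP := IsScalarTower.of_algebraMap_eq fun x => (hgS x).symm
  have h₃ : maximalIdeal S ≤ RingHom.ker (algebraMap S kP) := by
    intro y hy
    obtain ⟨x, rfl⟩ := hf₁' y
    change gS (algebraMap P S x) = 0
    rw [hgS, residue_eq_zero_iff]
    exact hmemP x hy
  -- the Jacobian criterion
  have hinj : Function.Injective (cotangentComplexBaseChange K S P kP) :=
    (Algebra.FormallySmooth.iff_injective_cotangentComplexBaseChange (R := K) (S := S) P kP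
      hf₁' hf₂ h₃).mp hSsm
  -- every element of `kP ⊗ I` is `1 ⊗ f`
  have htmul : ∀ z : kP ⊗[P] I, ∃ f : I, z = (1 : kP) ⊗ₜ[P] f := by
    intro z
    induction z using TensorProduct.induction_on with
    | zero => exact ⟨0, by rw [tmul_zero]⟩
    | tmul a x =>
      obtain ⟨p, rfl⟩ := Ideal.Quotient.mk_surjective a
      refine ⟨p • x, ?_⟩
      rw [tmul_smul, smul_tmul', ← Algebra.algebraMap_eq_smul_one]
      rfl
    | add z₁ z₂ h₁ h₂ =>
      obtain ⟨f₁, rfl⟩ := h₁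
      obtain ⟨f₂, rfl⟩ := h₂
      exact ⟨f₁ + f₂, by rw [tmul_add]⟩
  -- a basis of `kP ⊗ I` of the form `1 ⊗ fᵢ`; the `fᵢ` generate `I` (Nakayama)
  haveI : Module.Finite P I := Module.Finite.iff_fg.mpr hf₂
  let bI := Module.finBasis kP (kP ⊗[P] I)
  set c : ℕ := Module.finrank kP (kP ⊗[P] I) with hc
  choose fgen hfgen using fun i => htmul (bI i)
  have hspanI : Submodule.span P (Set.range fgen) = ⊤ :=
    IsLocalRing.span_eq_top_of_tmul_eq_basis fgen bI fun i => (hfgen i).symm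
  have hIgen : Ideal.span (Set.range fun i => ((fgen i : I) : P)) = I := by
    apply le_antisymm
    · exact Ideal.span_le.mpr (by rintro _ ⟨i, rfl⟩; exact (fgen i).2)
    · intro x hx
      have hx' : (⟨x, hx⟩ : I) ∈ Submodule.span P (Set.range fgen) := by
        rw [hspanI]; exact Submodule.mem_top
      have := Submodule.mem_map_of_mem (f := I.subtype) hx'
      rw [Submodule.map_span, ← Set.range_comp] at this
      exact this
  have hfgen_inj : ∀ i j, ((fgen i : I) : P) = ((fgen j : I) : P) → i = j := by
    intro i j hij
    apply bI.injective
    rw [hfgen i, hfgen j, Subtype.ext hij]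
  -- linear independence of the `fᵢ` in `𝔪/𝔪²`, from the injectivity of the Jacobian map
  have hindep : ∀ g : Fin c → P, (∑ i, g i * ((fgen i : I) : P)) ∈ (maximalIdeal P) ^ 2 →
      ∀ i, g i ∈ maximalIdeal P := by
    intro g hg i
    have hx : cotangentComplexBaseChange K S P kP (∑ i, residue P (g i) • bI i) = 0 := by
      rw [map_sum]
      have : ∀ j, cotangentComplexBaseChange K S P kP (residue P (g j) • bI j) =
          residue P (g j) • ((1 : kP) ⊗ₜ[P] D K P ((fgen j : I) : P)) := by
        intro j
        rw [map_smul, hfgen j, cotangentComplexBaseChange_tmul, one_smul, kerToTensor_apply]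
      simp_rw [this]
      exact sum_residue_smul_one_tmul_D_eq_zero g (fun j => ((fgen j : I) : P))
        (fun j => hIm (fgen j).2) hg
    have hzero : (∑ i, residue P (g i) • bI i) = 0 := hinj (hx.trans (map_zero _).symm)
    have := Fintype.linearIndependent_iff.mp bI.linearIndependent (fun i => residue P (g i))
      hzero i
    exact (residue_eq_zero_iff _).mp this
  -- Matsumura 14.2 for `P` and the `fᵢ`
  let sgen : Finset P := Finset.univ.image fun i => ((fgen i : I) : P)
  have hsgen : (sgen : Set P) = Set.range fun i => ((fgen i : I) : P) := by
    simp [sgen]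
  have hsm : (sgen : Set P) ⊆ maximalIdeal P := by
    rw [hsgen]
    rintro _ ⟨i, rfl⟩
    exact hIm (fgen i).2
  let eidx : Fin c ≃ ↥sgen :=
    Equiv.ofBijective (fun i => ⟨(fgen i : I), Finset.mem_image_of_mem _ (Finset.mem_univ i)⟩)
      ⟨fun i j hij => hfgen_inj i j (by simpa using congrArg Subtype.val hij), fun x => by
        obtain ⟨i, -, hi⟩ := Finset.mem_image.mp x.2
        exact ⟨i, Subtype.ext hi⟩⟩
  have hli : LinearIndependent (ResidueField P)
      (fun x : sgen => (maximalIdeal P).toCotangent ⟨x, hsm x.2⟩) := by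
    refine linearIndependent_toCotangent_of_forall sgen hsm fun g' hg' x => ?_
    have hsum : (∑ x : sgen, g' x * (x : P)) = ∑ i, g' (eidx i) * ((fgen i : I) : P) := by
      rw [← Equiv.sum_comp eidx]
      rfl
    rw [hsum] at hg'
    obtain ⟨i, rfl⟩ := eidx.surjective x
    exact hindep (fun i => g' (eidx i)) hg' i
  haveI hreg : IsRegularLocalRing (P ⧸ Ideal.span (sgen : Set P)) :=
    isRegularLocalRing_quotient_span sgen hsm hli
  have hspan_eq : Ideal.span (sgen : Set P) = I := by rw [hsgen, hIgen]
  let e : (P ⧸ Ideal.span (sgen : Set P)) ≃+* S :=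
    (Ideal.quotEquivOfEq hspan_eq).trans (RingHom.quotientKerEquivOfSurjective hf₁')
  exact @IsRegularLocalRing.of_ringEquiv _ _ hreg _ _ e

end Literature.AlgebraicGeometry.Resolution

end
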